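import Summits.KontsevichZagierPeriods.Zeta5Search.Barrier.ConeGammaSepMajorantFract
import Summits.KontsevichZagierPeriods.Zeta5Search.Barrier.ConeGammaLemmaFWindowsCells

/-!
# ζ(5) search — BARRIER: every separable majorant along every flow (reoriented), and WINDOWED LEMMA F with members

HONEST FRAMING (cell `pub-zeta5`): systematic search; no irrationality claim unless kernel-certified. MODEL objects under
Brown–Zudilin's (28)+(30) accounting ([BZ22] = arXiv:2210.03391; (28) observed, not proved): inequalities for BZ's saving
step function `𝒩 = torusN` along the flow `u ↦ u·s` of an ARBITRARY closed-box direction, and the resulting explicit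
UPPER-BOUND SCHEMA for the MODEL saving rate `Φ = phi30` in which a numerics seat only has to choose window end-points and
one member `(v_w, w_w)` of the 42-family per window; nothing here is about any `γ` of record, the cone's supremum (C2 OPEN),
S-E (CONJECTURED) or `ζ(5)`; no number or sentence of record moves; records in print UNMOVED. Prover P2 g24, sequel (G)
(«the reoriented-member glue», INBOX l.9206).

* **`torusN_flow_le_member`** — member `(v,w)` of `torusN_le_sepMajorant_fract` along the flow `θ = u·s` of ANY `s`, with
  the difference features REORIENTED: for `i ∉ {v,w}` the term `{u(s_v − s_i)}` is kept when `s_i ≤ s_v` and replaced by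
  `1 − {u(s_i − s_v)}` when `s_i > s_v` (`Int.fract_neg`), valid for every `u` off the walls `{u(s_i − s_v)} = 0`;
* `countable_memberWalls` — those walls form a countable set; `flow_hyp_of_not_mem_walls` — off the walls the
  hypothesis of `torusN_flow_le_member` holds;
* **`phi30_le_windows_members`** — WINDOWED LEMMA F WITH MEMBERS: for `s` in the closed box, end-points
  `0 < U₀ ≤ ⋯ ≤ U_W` with `U₀·(pair forms) ≤ 1`, and a member `(v_w, w_w)` per window, `Φ(aOfS s)` is at most the explicit
  J-expression (`J(R,x) = ∫_R^{Rx}{w}w⁻²dw`) assembled from `phi30_le_of_sepBound_windows₀` with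
  `c_w = 1 + #{i ∉ {v_w,w_w} : s_i > s_{v_w}}` and the member's (reoriented) features — no orientation hypothesis on `s`.
The values of such bounds (which members / windows are good at which direction) are DATA of the seats, not statements here.
CONVENTION (as in `ConeGammaLemmaFWindows`): every J-term appears as `x · ∫_R^{R·x} {t}t⁻²dt`; for a vanishing feature
`x = 0` the factor `x` kills the term (the interval integral over `R..0` is then Lean's junk value `0` of a non-integrable
integrand, multiplied by `0`) — read `x·J(R,x) := 0` at `x = 0`, which is the correct limit value.
-/

noncomputable section

open Set MeasureTheory Filter
open scoped Topology

namespace Summit.KontsevichZagierPeriods.Zeta5Search.Barrier.ConeGamma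

/-! ### A member along an arbitrary flow, reoriented -/

/-- **Member `(v,w)` along the flow of any `s`, reoriented.** For every `u` off the walls `{u(s_i − s_v)} = 0`
(`i ∉ {v,w}`, `s_i > s_v`):
`𝒩(u·s) ≤ 1 + {u(s₀+s_v)} + {u(s₀−s_v)} + Σ_{i∉{v,w}} ({u(s_v−s_i)} if s_i ≤ s_v, else 1 − {u(s_i−s_v)})
 − 2{u(s_v+s_w)} − Σ_{j∉{v,w}} {u(s_v+s_j)} + Σ_{reference path} {u(s_i+s_j)} − {u(s₀−s₂)} − {u(s₀−s₃)}`. -/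
theorem torusN_flow_le_member (s : Fin 8 → ℝ) {v w : Fin 7} (hvw : v ≠ w) {u : ℝ}
    (hu : ∀ i : Fin 7, i ≠ v → i ≠ w → s v.succ < s i.succ → Int.fract (u * (s i.succ - s v.succ)) ≠ 0) :
    (torusN (u • s) : ℝ) ≤ 1 + Int.fract (u * (s 0 + s v.succ)) + Int.fract (u * (s 0 - s v.succ))
      + (∑ i : Fin 7, if i = v ∨ i = w then (0 : ℝ) else
          if s i.succ ≤ s v.succ then Int.fract (u * (s v.succ - s i.succ))
          else 1 - Int.fract (u * (s i.succ - s v.succ)))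
      - 2 * Int.fract (u * (s v.succ + s w.succ))
      - (∑ j : Fin 7, if j = v ∨ j = w then (0 : ℝ) else Int.fract (u * (s v.succ + s j.succ)))
      + (Int.fract (u * (s 3 + s 5)) + Int.fract (u * (s 4 + s 6)) + Int.fract (u * (s 1 + s 6))
        + Int.fract (u * (s 1 + s 7)) + Int.fract (u * (s 4 + s 5)) + Int.fract (u * (s 2 + s 7)))
      - Int.fract (u * (s 0 - s 2)) - Int.fract (u * (s 0 - s 3)) := by
  have hF := torusN_le_sepMajorant_fract (u • s) hvw
  simp only [Pi.smul_apply, smul_eq_mul, ← mul_add, ← mul_sub] at hF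
  have hsum : (∑ i : Fin 7, if i = v ∨ i = w then (0 : ℝ) else Int.fract (u * (s v.succ - s i.succ))) =
      ∑ i : Fin 7, if i = v ∨ i = w then (0 : ℝ) else
        if s i.succ ≤ s v.succ then Int.fract (u * (s v.succ - s i.succ))
        else 1 - Int.fract (u * (s i.succ - s v.succ)) := by
    refine Finset.sum_congr rfl fun i _ => ?_
    by_cases hiv : i = v ∨ i = w
    · rw [if_pos hiv, if_pos hiv]
    · rw [if_neg hiv, if_neg hiv]
      push Not at hiv
      split_ifs with hle
      · rfl
      · rw [show u * (s v.succ - s i.succ) = -(u * (s i.succ - s v.succ)) by ring,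
          Int.fract_neg (hu i hiv.1 hiv.2 (lt_of_not_ge hle))]
  linarith [hsum]

/-- The walls of the reoriented member are countable. -/
theorem countable_memberWalls (s : Fin 8 → ℝ) (v : Fin 7) :
    (⋃ i : Fin 7, {u : ℝ | s v.succ < s i.succ ∧ Int.fract (u * (s i.succ - s v.succ)) = 0}).Countable := by
  refine Set.countable_iUnion fun i => ?_
  by_cases h : s v.succ < s i.succ
  · refine (countable_setOf_fract_mul_eq_zero (sub_pos.mpr h).ne').mono fun u hu => ?_
    exact hu.2
  · convert Set.countable_empty
    ext u
    simp [h]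

/-- Off the walls, the wall hypothesis of `torusN_flow_le_member` holds. -/
theorem flow_hyp_of_not_mem_walls (s : Fin 8 → ℝ) (v w : Fin 7) {u : ℝ}
    (hu : u ∉ ⋃ i : Fin 7, {u : ℝ | s v.succ < s i.succ ∧ Int.fract (u * (s i.succ - s v.succ)) = 0}) :
    ∀ i : Fin 7, i ≠ v → i ≠ w → s v.succ < s i.succ → Int.fract (u * (s i.succ - s v.succ)) ≠ 0 := by
  intro i _ _ hlt hzero
  exact hu (Set.mem_iUnion.mpr ⟨i, hlt, hzero⟩)


/-! ### WINDOWED LEMMA F with one member of the 42-family per window -/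

/-- **WINDOWED LEMMA F WITH MEMBERS (turnkey form of `phi30_le_of_sepBound_windows₀`).** Let `s` be in the closed box,
`0 < U₀ ≤ U₁ ≤ ⋯ ≤ U_W` with `U₀·h_k(aOfS s) ≤ 1` for all 28 forms, and for each window `w ≤ W` a member `(p_w, q_w)`,
`p_w ≠ q_w`, of the 42-family. Then there are window functionals `T_w(R)` — GIVEN EXPLICITLY: `T_w(R) = Σ_m ε_m x_m J(R,x_m)`
over the reoriented features of member `(p_w,q_w)` (`J(R,x) = ∫_R^{Rx}{t}t⁻²dt`), written out term by term below — with
`Φ(aOfS s) ≤ Σ_{w<W} [c_w(1/U_w − 1/U_{w+1}) − (T_w(U_w) − T_w(U_{w+1}))] + c_W/U_W − T_W(U_W)`,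
`c_w = 1 + #{i ∉ {p_w,q_w} : s_i > s_{p_w}}`. No orientation hypothesis on `s`; which members and windows are good at a
given direction is DATA, not a statement here. -/
theorem phi30_le_windows_members (s : Fin 8 → ℝ) (h0 : 0 < s 0) (hlo : ∀ j : Fin 7, 0 ≤ s j.succ)
    (hhi : ∀ j : Fin 7, s j.succ ≤ s 0) (W : ℕ) (U : ℕ → ℝ) (hU0 : 0 < U 0)
    (hh : ∀ k : Fin 28, U 0 * h28 (aOfS s) k ≤ 1) (hU : ∀ w < W, U w ≤ U (w + 1))
    (p q : ℕ → Fin 7) (hpq : ∀ w ≤ W, p w ≠ q w) :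
    ∃ T : ℕ → ℝ → ℝ,
      (∀ w R, T w R =
        (s 0 + s (p w).succ) * (∫ t in R..(R * (s 0 + s (p w).succ)), Int.fract t / t ^ 2)
        + (s 0 - s (p w).succ) * (∫ t in R..(R * (s 0 - s (p w).succ)), Int.fract t / t ^ 2)
        - 2 * ((s (p w).succ + s (q w).succ) * ∫ t in R..(R * (s (p w).succ + s (q w).succ)), Int.fract t / t ^ 2)
        + (∑ i : Fin 7, if i = p w ∨ i = q w then (0 : ℝ) else
            if s i.succ ≤ s (p w).succ then
              (s (p w).succ - s i.succ) * ∫ t in R..(R * (s (p w).succ - s i.succ)), Int.fract t / t ^ 2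
            else -((s i.succ - s (p w).succ) * ∫ t in R..(R * (s i.succ - s (p w).succ)), Int.fract t / t ^ 2))
        - (∑ j : Fin 7, if j = p w ∨ j = q w then (0 : ℝ) else
            (s (p w).succ + s j.succ) * ∫ t in R..(R * (s (p w).succ + s j.succ)), Int.fract t / t ^ 2)
        + ((s 3 + s 5) * (∫ t in R..(R * (s 3 + s 5)), Int.fract t / t ^ 2)
          + (s 4 + s 6) * (∫ t in R..(R * (s 4 + s 6)), Int.fract t / t ^ 2)
          + (s 1 + s 6) * (∫ t in R..(R * (s 1 + s 6)), Int.fract t / t ^ 2)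
          + (s 1 + s 7) * (∫ t in R..(R * (s 1 + s 7)), Int.fract t / t ^ 2)
          + (s 4 + s 5) * (∫ t in R..(R * (s 4 + s 5)), Int.fract t / t ^ 2)
          + (s 2 + s 7) * (∫ t in R..(R * (s 2 + s 7)), Int.fract t / t ^ 2))
        - (s 0 - s 2) * (∫ t in R..(R * (s 0 - s 2)), Int.fract t / t ^ 2)
        - (s 0 - s 3) * (∫ t in R..(R * (s 0 - s 3)), Int.fract t / t ^ 2)) ∧
      phi30 (aOfS s) ≤
        (∑ w ∈ Finset.range W, ((1 + ∑ i : Fin 7, if i = p w ∨ i = q w then (0 : ℝ) else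
            if s i.succ ≤ s (p w).succ then 0 else 1) * (1 / U w - 1 / U (w + 1)) - (T w (U w) - T w (U (w + 1)))))
        + ((1 + ∑ i : Fin 7, if i = p W ∨ i = q W then (0 : ℝ) else if s i.succ ≤ s (p W).succ then 0 else 1) / U W
          - T W (U W)) := by
  have h1lo := hlo 0; have h2lo := hlo 1; have h3lo := hlo 2; have h4lo := hlo 3; have h5lo := hlo 4
  have h6lo := hlo 5; have h7lo := hlo 6
  have h1hi := hhi 0; have h2hi := hhi 1; have h3hi := hhi 2; have h4hi := hhi 3; have h5hi := hhi 4
  have h6hi := hhi 5; have h7hi := hhi 6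
  simp only [Fin.succ_zero_eq_one, Fin.succ_one_eq_two] at h1lo h2lo h1hi h2hi
  change 0 ≤ s 3 at h3lo; change 0 ≤ s 4 at h4lo; change 0 ≤ s 5 at h5lo; change 0 ≤ s 6 at h6lo
  change 0 ≤ s 7 at h7lo
  change s 3 ≤ s 0 at h3hi; change s 4 ≤ s 0 at h4hi; change s 5 ≤ s 0 at h5hi; change s 6 ≤ s 0 at h6hi
  change s 7 ≤ s 0 at h7hi
  have hbox : BZBox (aOfS s) := by
    refine ⟨by rwa [sParam_aOfS], fun j => ⟨by rw [sParam_aOfS]; exact hlo j, by rw [sParam_aOfS]; exact hhi j⟩⟩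
  -- the reoriented feature families of the members `(p w, q w)`
  set xA : ℕ → Fin 11 → ℝ := fun w => ![s 0 + s (p w).succ, s 0 - s (p w).succ, s (p w).succ + s (q w).succ,
    s 3 + s 5, s 4 + s 6, s 1 + s 6, s 1 + s 7, s 4 + s 5, s 2 + s 7, s 0 - s 2, s 0 - s 3] with hxA
  set εA : Fin 11 → ℝ := ![1, 1, -2, 1, 1, 1, 1, 1, 1, -1, -1] with hεA
  set xB : ℕ → Fin 7 → ℝ := fun w i =>
    if s i.succ ≤ s (p w).succ then s (p w).succ - s i.succ else s i.succ - s (p w).succ with hxB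
  set εB : ℕ → Fin 7 → ℝ := fun w i =>
    if i = p w ∨ i = q w then 0 else if s i.succ ≤ s (p w).succ then 1 else -1 with hεB
  set xC : ℕ → Fin 7 → ℝ := fun w j => s (p w).succ + s j.succ with hxC
  set εC : ℕ → Fin 7 → ℝ := fun w j => if j = p w ∨ j = q w then 0 else -1 with hεC
  set x : ℕ → Fin 11 ⊕ (Fin 7 ⊕ Fin 7) → ℝ := fun w => Sum.elim (xA w) (Sum.elim (xB w) (xC w)) with hx
  set ε : ℕ → Fin 11 ⊕ (Fin 7 ⊕ Fin 7) → ℝ := fun w => Sum.elim εA (Sum.elim (εB w) (εC w)) with hε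
  set c : ℕ → ℝ := fun w => 1 + ∑ i : Fin 7, if i = p w ∨ i = q w then (0 : ℝ) else
    if s i.succ ≤ s (p w).succ then 0 else 1 with hc
  set S : Set ℝ := ⋃ w : ℕ, ⋃ i : Fin 7,
    {u : ℝ | s (p w).succ < s i.succ ∧ Int.fract (u * (s i.succ - s (p w).succ)) = 0} with hSdef
  have hS : S.Countable := Set.countable_iUnion fun w => countable_memberWalls s (p w)
  have hSum7 : ∑ i : Fin 7, s i.succ = s 1 + s 2 + s 3 + s 4 + s 5 + s 6 + s 7 := by
    simp only [Fin.sum_univ_seven, Fin.succ_zero_eq_one, Fin.succ_one_eq_two, Fin.reduceSucc]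
  -- the window functional
  set T : ℕ → ℝ → ℝ := fun w R => ∑ m : Fin 11 ⊕ (Fin 7 ⊕ Fin 7),
    ε w m * (x w m * ∫ t in R..(R * x w m), Int.fract t / t ^ 2) with hT
  -- per-member algebra (w arbitrary)
  have hBprod : ∀ w (i : Fin 7), εB w i * xB w i =
      if i = p w ∨ i = q w then 0 else (s (p w).succ - s i.succ) := by
    intro w i; simp only [hεB, hxB]; split_ifs <;> ring
  have hCprod : ∀ w (j : Fin 7), εC w j * xC w j =
      if j = p w ∨ j = q w then 0 else -(s (p w).succ + s j.succ) := by
    intro w j; simp only [hεC, hxC]; split_ifs <;> ring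
  have hAlin : ∀ w, ∑ m : Fin 11, εA m * xA w m = (s 0 + s (p w).succ) + (s 0 - s (p w).succ)
      - 2 * (s (p w).succ + s (q w).succ) + (s 3 + s 5) + (s 4 + s 6) + (s 1 + s 6) + (s 1 + s 7) + (s 4 + s 5)
      + (s 2 + s 7) - (s 0 - s 2) - (s 0 - s 3) := by
    intro w
    simp only [Fin.sum_univ_succ, Fin.sum_univ_zero, hxA, hεA, Matrix.cons_val_zero, Matrix.cons_val_succ]
    ring
  have hlin : ∀ w ≤ W, ∑ m ∈ (Finset.univ : Finset (Fin 11 ⊕ (Fin 7 ⊕ Fin 7))), ε w m * x w m = 0 := by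
    intro w hw
    rw [Fintype.sum_sum_type, Fintype.sum_sum_type]
    simp only [hx, hε, Sum.elim_inl, Sum.elim_inr]
    rw [hAlin w, Finset.sum_congr rfl fun i _ => hBprod w i, Finset.sum_congr rfl fun j _ => hCprod w j,
      sum_ite_pair_eq (hpq w hw) (fun i => s (p w).succ - s i.succ),
      sum_ite_pair_eq (hpq w hw) (fun j => -(s (p w).succ + s j.succ))]
    simp only [Finset.sum_sub_distrib, Finset.sum_add_distrib, Finset.sum_neg_distrib, Finset.sum_const,
      Finset.card_univ, Fintype.card_fin, nsmul_eq_mul, Nat.cast_ofNat, hSum7]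
    ring
  have hx0 : ∀ w ≤ W, ∀ m ∈ (Finset.univ : Finset (Fin 11 ⊕ (Fin 7 ⊕ Fin 7))), 0 ≤ x w m := by
    intro w _
    have hv0 : 0 ≤ s (p w).succ := hlo (p w)
    have hvhi : s (p w).succ ≤ s 0 := hhi (p w)
    have hw0 : 0 ≤ s (q w).succ := hlo (q w)
    rintro (m | m | m) _
    · simp only [hx, Sum.elim_inl]
      fin_cases m <;> simp [hxA] <;> linarith
    · simp only [hx, Sum.elim_inr, Sum.elim_inl, hxB]
      split_ifs with hle
      · linarith
      · linarith
    · simp only [hx, Sum.elim_inr, hxC]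
      linarith [hlo m]
  -- the separable bound on every window, off the walls
  have hAfr : ∀ w (u : ℝ), ∑ m : Fin 11, εA m * Int.fract (u * xA w m) =
      Int.fract (u * (s 0 + s (p w).succ)) + Int.fract (u * (s 0 - s (p w).succ))
      - 2 * Int.fract (u * (s (p w).succ + s (q w).succ))
      + Int.fract (u * (s 3 + s 5)) + Int.fract (u * (s 4 + s 6)) + Int.fract (u * (s 1 + s 6))
      + Int.fract (u * (s 1 + s 7)) + Int.fract (u * (s 4 + s 5)) + Int.fract (u * (s 2 + s 7))
      - Int.fract (u * (s 0 - s 2)) - Int.fract (u * (s 0 - s 3)) := by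
    intro w u
    simp only [Fin.sum_univ_succ, Fin.sum_univ_zero, hxA, hεA, Matrix.cons_val_zero, Matrix.cons_val_succ]
    ring
  have hBfr : ∀ w (u : ℝ), (∑ i : Fin 7, if i = p w ∨ i = q w then (0 : ℝ) else
      if s i.succ ≤ s (p w).succ then Int.fract (u * (s (p w).succ - s i.succ))
      else 1 - Int.fract (u * (s i.succ - s (p w).succ))) =
      (∑ i : Fin 7, if i = p w ∨ i = q w then (0 : ℝ) else if s i.succ ≤ s (p w).succ then 0 else 1)
      + ∑ i : Fin 7, εB w i * Int.fract (u * xB w i) := by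
    intro w u
    rw [← Finset.sum_add_distrib]
    refine Finset.sum_congr rfl fun i _ => ?_
    simp only [hεB, hxB]
    split_ifs <;> ring
  have hCfr : ∀ w (u : ℝ), ∑ j : Fin 7, εC w j * Int.fract (u * xC w j) =
      -(∑ j : Fin 7, if j = p w ∨ j = q w then (0 : ℝ) else Int.fract (u * (s (p w).succ + s j.succ))) := by
    intro w u
    rw [← Finset.sum_neg_distrib]
    refine Finset.sum_congr rfl fun j _ => ?_
    simp only [hεC, hxC]
    split_ifs <;> ring
  have hbound : ∀ w ≤ W, ∀ u : ℝ, u ∉ S → (savingN (aOfS s) u : ℝ) ≤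
      c w + ∑ m ∈ (Finset.univ : Finset (Fin 11 ⊕ (Fin 7 ⊕ Fin 7))), ε w m * Int.fract (u * x w m) := by
    intro w hw u hu
    have huw : u ∉ ⋃ i : Fin 7, {u : ℝ | s (p w).succ < s i.succ ∧ Int.fract (u * (s i.succ - s (p w).succ)) = 0} :=
      fun h => hu (Set.mem_iUnion.mpr ⟨w, h⟩)
    have hF := torusN_flow_le_member s (hpq w hw) (flow_hyp_of_not_mem_walls s (p w) (q w) huw)
    rw [savingN_eq_torusN_of_BZBox hbox, sParam_aOfS]
    rw [Fintype.sum_sum_type, Fintype.sum_sum_type]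
    simp only [hx, hε, hc, Sum.elim_inl, Sum.elim_inr]
    rw [hAfr w u, hCfr w u]
    rw [hBfr w u] at hF
    linarith
  -- apply the window schema
  have key := phi30_le_of_sepBound_windows₀ hbox W U hU0 hh hU (fun _ => Finset.univ) ε x c hx0 hlin hS
    (fun w hw u _ hu => hbound w hw.le u hu) (fun u _ hu => hbound W le_rfl u hu)
  refine ⟨T, fun w R => ?_, ?_⟩
  · -- the explicit form of `T w R`
    have hBJ : ∀ i : Fin 7, εB w i * (xB w i * ∫ t in R..(R * xB w i), Int.fract t / t ^ 2) =
        if i = p w ∨ i = q w then (0 : ℝ) else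
          if s i.succ ≤ s (p w).succ then
            (s (p w).succ - s i.succ) * ∫ t in R..(R * (s (p w).succ - s i.succ)), Int.fract t / t ^ 2
          else -((s i.succ - s (p w).succ) * ∫ t in R..(R * (s i.succ - s (p w).succ)), Int.fract t / t ^ 2) := by
      intro i; simp only [hεB, hxB]; split_ifs <;> ring
    have hCJ : ∀ j : Fin 7, εC w j * (xC w j * ∫ t in R..(R * xC w j), Int.fract t / t ^ 2) =
        if j = p w ∨ j = q w then (0 : ℝ) else
          -((s (p w).succ + s j.succ) * ∫ t in R..(R * (s (p w).succ + s j.succ)), Int.fract t / t ^ 2) := by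
      intro j; simp only [hεC, hxC]; split_ifs <;> ring
    have hCJ' : (∑ j : Fin 7, if j = p w ∨ j = q w then (0 : ℝ) else
        -((s (p w).succ + s j.succ) * ∫ t in R..(R * (s (p w).succ + s j.succ)), Int.fract t / t ^ 2)) =
        -(∑ j : Fin 7, if j = p w ∨ j = q w then (0 : ℝ) else
          (s (p w).succ + s j.succ) * ∫ t in R..(R * (s (p w).succ + s j.succ)), Int.fract t / t ^ 2) := by
      rw [← Finset.sum_neg_distrib]
      refine Finset.sum_congr rfl fun j _ => ?_
      split_ifs <;> ring
    simp only [hT]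
    rw [Fintype.sum_sum_type, Fintype.sum_sum_type]
    simp only [hx, hε, Sum.elim_inl, Sum.elim_inr]
    rw [Finset.sum_congr rfl fun i _ => hBJ i, Finset.sum_congr rfl fun j _ => hCJ j, hCJ']
    simp only [Fin.sum_univ_succ, Fin.sum_univ_zero, hxA, hεA, Matrix.cons_val_zero, Matrix.cons_val_succ]
    ring
  · -- the bound
    have hTdiff : ∀ w, ∑ m ∈ (Finset.univ : Finset (Fin 11 ⊕ (Fin 7 ⊕ Fin 7))), ε w m * (x w m *
        ((∫ v in (U w)..(U w * x w m), Int.fract v / v ^ 2) - ∫ v in (U (w + 1))..(U (w + 1) * x w m),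
          Int.fract v / v ^ 2)) = T w (U w) - T w (U (w + 1)) := by
      intro w
      simp only [hT, ← Finset.sum_sub_distrib]
      refine Finset.sum_congr rfl fun m _ => ?_
      ring
    have hTlast : ∑ m ∈ (Finset.univ : Finset (Fin 11 ⊕ (Fin 7 ⊕ Fin 7))), ε W m * (x W m *
        ∫ v in (U W)..(U W * x W m), Int.fract v / v ^ 2) = T W (U W) := by
      simp only [hT]
    simp only [hTdiff, hTlast, hc] at key
    exact key

end Summit.KontsevichZagierPeriods.Zeta5Search.Barrier.ConeGamma

end
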